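import Summits.QuantumFields.YangMills.Theorems.BalabanUVNodesN07PointFeasibilityOneLevelSymbolBridge
import Summits.QuantumFields.YangMills.Theorems.BalabanUVNodesN07AliasSumMarginSharpSigned
import HarnessLib

/-!
# DAG node N07 [B11], road R0′ — the ONE-LEVEL MARGIN IN x-SPACE WITH THE SHARP CONSTANT ONE, every odd block side `n ≥ 3`: for every dimension `d`,
# every torus and every block function `β`, `‖Δ⁻¹Q′ᴴβ‖² ≤ Re Σ_y conj β(y)·(Δ⁻²Q′ᴴβ)(ny + c₀)` — the centre form dominates the matched form

Cell `pub-ymgap` (HUMAN RULINGS D-0062 ∕ D-0149 ∕ D-0154), width seat `pub-ymgap-dag-n07-w5` g2, 2026-08-28.  `--kind proof --supports <K1 key>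
--as helper` (count-neutral; INTENT-8 cell bus 11:41Z).  ONE composition: dag-n07-w7 g5's sharp display margin (`…N07AliasSumMarginSharpSigned.displayMargin_sharp_hDisp`, on top of their partial-
fraction proof of «K₀(θ) ≤ K(θ)» for every odd `L`) inhabits the hypothesis `hDisp` of this base's `…OneLevelSymbolBridge.norm_sq_lapInv_le_centreForm
_of_display` (p626779 ∘ p625080) at the per-coordinate constant `c₁ = 1`.  The `n = 3` instance is `…SharpSmallLSymbols.norm_sq_lapInv_le_centreForm
_sharp_three` (p630239); the `π^{−d}` edition is `…OneLevelMarginPi` (p630272).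

HONEST FRAMING (binding).  Count-neutral helper; one averaging level; asserts NOTHING of [B11]∕[B6]∕[3]; `(P)_D` ∕ (L2)–(L4) OPEN; nothing consumed under
road (a); `hker` ∕ stub 1 ∕ K0⁷ ∕ K1⁹ NOT closed; N07 NOT discharged; counts unmoved; no summit statement is proved by this seat — R4 closes the conditional
finite-𝕋⁴ rung `BalabanLadder.UV` only; nothing continuum ∕ ℝ⁴ ∕ OS ∕ mass gap ∕ Clay.  No `sorry`, no `def`, no `instance`, no `notation`.
-/

noncomputable section

open scoped BigOperators Matrix ComplexConjugate
open Finset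

namespace Summit.QuantumFields.YangMills.BalabanUVNodes.N07PointFeasibilityOneLevel

open Literature.MathematicalPhysics.QuantumFieldTheory.Balaban1983to89
open B5Prop11Plancherel (Tor fine)
open B5Block118 (bpt QsOp)
open B5LaplaceInverse (LapSinv)
open B5Substitution125 (Mop)
open Summit.QuantumFields.YangMills.Theorems.N07AliasSumMarginSharp (displayMargin_sharp_hDisp)

variable {d : ℕ} (n : ℕ) [NeZero n] (M : Fin d → ℕ) [hM : ∀ μ, NeZero (M μ)]

/-- ★★★ **THE SHARP ONE-LEVEL MARGIN IN x-SPACE**: for odd `n = 2c₀+1 ≥ 3`, on the torus `Tor (fine n M)` of any dimension and coarse size, for EVERY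
block function `β`: `Σ_x |(Δ⁻¹Q′ᴴβ)(x)|² ≤ Re Σ_y conj β(y)·(Δ⁻²Q′ᴴβ)(ny + c₀)` — constant ONE.
[cite: Balaban1984PropagatorsI, Sect. C p.22, (1.30)–(1.33) p.23; Balaban1984PropagatorsII, (2.22) p.226; Balaban1987RG1, (0.4) p.253] -/
theorem norm_sq_lapInv_le_centreForm_sharp (hn : Odd n) (h3 : 3 ≤ n) (c₀ : Fin d → Fin n) (hc₀ : ∀ ν, 2 * (c₀ ν : ℕ) + 1 = n)
    (β : Tor M → ℂ) :
    ∑ x, ‖(LapSinv (fine n M) (n : ℂ) *ᵥ ((QsOp n M)ᴴ *ᵥ β)) x‖ ^ 2 ≤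
      (star β ⬝ᵥ (fun y => (LapSinv (fine n M) (n : ℂ) *ᵥ (LapSinv (fine n M) (n : ℂ) *ᵥ ((QsOp n M)ᴴ *ᵥ β)))
        (bpt n M y c₀))).re := by
  have h := norm_sq_lapInv_le_centreForm_of_display n M c₀ hc₀ (c₁ := 1) zero_le_one le_rfl
    (displayMargin_sharp_hDisp hn h3) β
  rwa [one_pow, one_mul] at h

/-- ★★★ the same with the matched form written as `⟨β, Q′Δ⁻²Q′ᴴβ⟩`: `Re⟨β, Q′Δ⁻²Q′ᴴβ⟩ ≤ Re Σ_y conj β(y)·(Δ⁻²Q′ᴴβ)(ny + c₀)`.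
[cite: Balaban1984PropagatorsI, Sect. C p.22; Balaban1984PropagatorsII, (2.22) p.226] -/
theorem matchedForm_le_centreForm_sharp (hn : Odd n) (h3 : 3 ≤ n) (c₀ : Fin d → Fin n) (hc₀ : ∀ ν, 2 * (c₀ ν : ℕ) + 1 = n)
    (β : Tor M → ℂ) :
    (star β ⬝ᵥ (Mop n M (n : ℂ) *ᵥ β)).re ≤
      (star β ⬝ᵥ (fun y => (LapSinv (fine n M) (n : ℂ) *ᵥ (LapSinv (fine n M) (n : ℂ) *ᵥ ((QsOp n M)ᴴ *ᵥ β)))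
        (bpt n M y c₀))).re := by
  rw [matchedForm_eq_norm_sq, Complex.ofReal_re]
  exact norm_sq_lapInv_le_centreForm_sharp n M hn h3 c₀ hc₀ β

end Summit.QuantumFields.YangMills.BalabanUVNodes.N07PointFeasibilityOneLevel

end
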